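import Mathlib
import HarnessLib

/-!
# Nested thin sectors at a base point of `ℝ³`: the sign lemma

(Line `janus-bands`, crux `ArrangementNormalForm`, stub `stub_separateHigh`, part `HHKSign` of
the wall-invariant termwise-split lemma `separateThree_hHk` in base dimension `3` with fibres.)
Along a nested thin sector `z₁ + t (d + v (Q + u S))` every affine form of the base has the value
`c₀ + t (p + v (q + u r))`. THE SIGN LEMMA (`eventually_sign3`, registered as
`separateThreeHHK_sign`): finitely many such forms are, for all small `δt`, then all small `δ`,
then all small `ε`, either all positive on the open box `(0, δt) × (0, δ) × (0, ε)` or one of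
them is non-positive there — so a nested sector lies inside the (effective) base polyhedron or
misses it. One form: the first non-zero coefficient among `c₀, p, q, r` decides
(`eventually_sign_level`, `eventually_sign_one3`).
-/

noncomputable section

open Set Filter Topology

namespace Summit.KontsevichZagierPeriods.ArrangementNormalForm.JanusBands

namespace SepHHK

/-! ### The sign lemma -/

/-- One level: a non-zero constant term dominates a bounded perturbation for small scales. -/
theorem eventually_sign_level {c M : ℝ} (hc : c ≠ 0) (hM : 0 ≤ M) :
    ∀ᶠ δ in 𝓝[>] (0 : ℝ), ∀ s ∈ Ioo (0 : ℝ) δ, ∀ B : ℝ, |B| ≤ M →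
      (0 < c → 0 < c + s * B) ∧ (c < 0 → c + s * B < 0) := by
  have hc' : 0 < |c| / (M + 1) := div_pos (abs_pos.2 hc) (by linarith)
  filter_upwards [Ioo_mem_nhdsGT hc'] with δ hδ s hs B hB
  have hsB : |s * B| < |c| := by
    rw [abs_mul, abs_of_pos hs.1]
    have h1 : s * |B| ≤ s * M := mul_le_mul_of_nonneg_left hB hs.1.le
    have h2 : s * M < |c| / (M + 1) * (M + 1) := by
      have := hs.2.trans hδ.2
      nlinarith
    rw [div_mul_cancel₀ _ (by linarith : (M + 1) ≠ 0)] at h2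
    linarith
  constructor
  · intro h
    rw [abs_of_pos h] at hsB
    linarith [neg_abs_le (s * B)]
  · intro h
    rw [abs_of_neg h] at hsB
    linarith [le_abs_self (s * B)]

/-- One affine form `c₀ + t (p + v (q + u r))` has a constant sign on all small open boxes. -/
theorem eventually_sign_one3 (c₀ p q r : ℝ) :
    ∀ᶠ δt in 𝓝[>] (0 : ℝ), ∀ᶠ δ in 𝓝[>] (0 : ℝ), ∀ᶠ ε in 𝓝[>] (0 : ℝ),
      (∀ t ∈ Ioo (0 : ℝ) δt, ∀ v ∈ Ioo (0 : ℝ) δ, ∀ u ∈ Ioo (0 : ℝ) ε,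
          0 < c₀ + t * (p + v * (q + u * r))) ∨
      (∀ t ∈ Ioo (0 : ℝ) δt, ∀ v ∈ Ioo (0 : ℝ) δ, ∀ u ∈ Ioo (0 : ℝ) ε,
          c₀ + t * (p + v * (q + u * r)) ≤ 0) := by
  have hqr : ∀ u ∈ Ioo (0 : ℝ) 1, |q + u * r| ≤ |q| + |r| := fun u hu => by
    calc |q + u * r| ≤ |q| + |u * r| := abs_add_le _ _
      _ = |q| + |u| * |r| := by rw [abs_mul]
      _ ≤ |q| + 1 * |r| := by gcongr; rw [abs_of_pos hu.1]; exact hu.2.le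
      _ = |q| + |r| := by ring
  have hpqr : ∀ v ∈ Ioo (0 : ℝ) 1, ∀ u ∈ Ioo (0 : ℝ) 1, |p + v * (q + u * r)| ≤ |p| + (|q| + |r|) := by
    intro v hv u hu
    calc |p + v * (q + u * r)| ≤ |p| + |v * (q + u * r)| := abs_add_le _ _
      _ = |p| + |v| * |q + u * r| := by rw [abs_mul]
      _ ≤ |p| + 1 * (|q| + |r|) := by
          gcongr
          · rw [abs_of_pos hv.1]; exact hv.2.le
          · exact hqr u hu
      _ = |p| + (|q| + |r|) := by ring
  by_cases hc₀ : c₀ ≠ 0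
  · -- the constant term decides
    filter_upwards [eventually_sign_level hc₀ (by positivity : (0 : ℝ) ≤ |p| + (|q| + |r|))]
      with δt hδt
    filter_upwards [Ioo_mem_nhdsGT one_pos] with δ hδ
    filter_upwards [Ioo_mem_nhdsGT one_pos] with ε hε
    rcases lt_or_gt_of_ne hc₀ with hneg | hpos
    · refine Or.inr fun t ht v hv u hu => le_of_lt ?_
      exact (hδt t ht _ (hpqr v ⟨hv.1, hv.2.trans hδ.2⟩ u ⟨hu.1, hu.2.trans hε.2⟩)).2 hneg
    · refine Or.inl fun t ht v hv u hu => ?_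
      exact (hδt t ht _ (hpqr v ⟨hv.1, hv.2.trans hδ.2⟩ u ⟨hu.1, hu.2.trans hε.2⟩)).1 hpos
  push Not at hc₀
  subst hc₀
  by_cases hp : p ≠ 0
  · -- the `t`-slope decides
    filter_upwards [self_mem_nhdsWithin] with δt _
    filter_upwards [eventually_sign_level hp (by positivity : (0 : ℝ) ≤ |q| + |r|)] with δ hδ
    filter_upwards [Ioo_mem_nhdsGT one_pos] with ε hε
    rcases lt_or_gt_of_ne hp with hneg | hpos
    · refine Or.inr fun t ht v hv u hu => ?_
      have h := (hδ v hv _ (hqr u ⟨hu.1, hu.2.trans hε.2⟩)).2 hneg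
      nlinarith [ht.1]
    · refine Or.inl fun t ht v hv u hu => ?_
      have h := (hδ v hv _ (hqr u ⟨hu.1, hu.2.trans hε.2⟩)).1 hpos
      nlinarith [ht.1]
  push Not at hp
  subst hp
  by_cases hq : q ≠ 0
  · -- the `v`-slope decides
    filter_upwards [self_mem_nhdsWithin] with δt _
    filter_upwards [self_mem_nhdsWithin] with δ _
    filter_upwards [eventually_sign_level hq (abs_nonneg r)] with ε hε
    rcases lt_or_gt_of_ne hq with hneg | hpos
    · refine Or.inr fun t ht v hv u hu => ?_
      have h := (hε u hu r le_rfl).2 hneg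
      nlinarith [ht.1, hv.1, mul_pos ht.1 hv.1]
    · refine Or.inl fun t ht v hv u hu => ?_
      have h := (hε u hu r le_rfl).1 hpos
      nlinarith [ht.1, hv.1, mul_pos ht.1 hv.1]
  · -- the `u`-slope decides
    push Not at hq
    subst hq
    filter_upwards [self_mem_nhdsWithin] with δt _
    filter_upwards [self_mem_nhdsWithin] with δ _
    filter_upwards [self_mem_nhdsWithin] with ε _
    rcases le_or_gt r 0 with hr | hr
    · refine Or.inr fun t ht v hv u hu => ?_
      have : 0 ≤ t * (v * (u * -r)) :=
        mul_nonneg ht.1.le (mul_nonneg hv.1.le (mul_nonneg hu.1.le (neg_nonneg.2 hr)))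
      nlinarith
    · refine Or.inl fun t ht v hv u hu => ?_
      have : 0 < t * (v * (u * r)) := by
        have := ht.1; have := hv.1; have := hu.1
        positivity
      nlinarith

/-- **The sign lemma.** Finitely many affine forms `c₀ j + t (p j + v (q j + u r j))` are, for
all small `δt, δ, ε`, either all positive on the open box or one of them is non-positive there. -/
theorem eventually_sign3 {m : ℕ} (c₀ p q r : Fin m → ℝ) :
    ∀ᶠ δt in 𝓝[>] (0 : ℝ), ∀ᶠ δ in 𝓝[>] (0 : ℝ), ∀ᶠ ε in 𝓝[>] (0 : ℝ),
      (∀ t ∈ Ioo (0 : ℝ) δt, ∀ v ∈ Ioo (0 : ℝ) δ, ∀ u ∈ Ioo (0 : ℝ) ε, ∀ j,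
          0 < c₀ j + t * (p j + v * (q j + u * r j))) ∨
      (∃ j, ∀ t ∈ Ioo (0 : ℝ) δt, ∀ v ∈ Ioo (0 : ℝ) δ, ∀ u ∈ Ioo (0 : ℝ) ε,
          c₀ j + t * (p j + v * (q j + u * r j)) ≤ 0) := by
  have h : ∀ᶠ δt in 𝓝[>] (0 : ℝ), ∀ j, ∀ᶠ δ in 𝓝[>] (0 : ℝ), ∀ᶠ ε in 𝓝[>] (0 : ℝ),
      (∀ t ∈ Ioo (0 : ℝ) δt, ∀ v ∈ Ioo (0 : ℝ) δ, ∀ u ∈ Ioo (0 : ℝ) ε,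
          0 < c₀ j + t * (p j + v * (q j + u * r j))) ∨
      (∀ t ∈ Ioo (0 : ℝ) δt, ∀ v ∈ Ioo (0 : ℝ) δ, ∀ u ∈ Ioo (0 : ℝ) ε,
          c₀ j + t * (p j + v * (q j + u * r j)) ≤ 0) :=
    eventually_all.2 fun j => eventually_sign_one3 (c₀ j) (p j) (q j) (r j)
  filter_upwards [h] with δt hδt
  have h2 := eventually_all.2 hδt
  filter_upwards [h2] with δ hδ
  have h3 := eventually_all.2 hδ
  filter_upwards [h3] with ε hε
  by_cases hall : ∀ j, ∀ t ∈ Ioo (0 : ℝ) δt, ∀ v ∈ Ioo (0 : ℝ) δ, ∀ u ∈ Ioo (0 : ℝ) ε,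
      0 < c₀ j + t * (p j + v * (q j + u * r j))
  · exact Or.inl fun t ht v hv u hu j => hall j t ht v hv u hu
  · push Not at hall
    obtain ⟨j, t, ht, v, hv, u, hu, hle⟩ := hall
    refine Or.inr ⟨j, ?_⟩
    rcases hε j with h | h
    · exact absurd (h t ht v hv u hu) (not_lt.2 hle)
    · exact h

end SepHHK

/-- **The sign lemma for nested thin sectors** (registered part of `stub_separateHigh`, base
dimension `3` with fibres; literal form of `SepHHK.eventually_sign3`): finitely many affine forms
`c₀ j + t (p j + v (q j + u r j))` are, for all small `δt`, all small `δ`, all small `ε`, either all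
positive on the open box `(0, δt) × (0, δ) × (0, ε)` or one of them is non-positive there. -/
theorem separateThreeHHK_sign (m : ℕ) (c₀ p q r : Fin m → ℝ) : ∀ᶠ δt in nhdsWithin (0 : ℝ) (Set.Ioi 0), ∀ᶠ δ in nhdsWithin (0 : ℝ) (Set.Ioi 0), ∀ᶠ ε in nhdsWithin (0 : ℝ) (Set.Ioi 0), (∀ t ∈ Set.Ioo (0 : ℝ) δt, ∀ v ∈ Set.Ioo (0 : ℝ) δ, ∀ u ∈ Set.Ioo (0 : ℝ) ε, ∀ j, 0 < c₀ j + t * (p j + v * (q j + u * r j))) ∨ (∃ j, ∀ t ∈ Set.Ioo (0 : ℝ) δt, ∀ v ∈ Set.Ioo (0 : ℝ) δ, ∀ u ∈ Set.Ioo (0 : ℝ) ε, c₀ j + t * (p j + v * (q j + u * r j)) ≤ 0) := by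
  exact SepHHK.eventually_sign3 c₀ p q r

end Summit.KontsevichZagierPeriods.ArrangementNormalForm.JanusBands
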